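import Summits.BirchSwinnertonDyer.BirchSwinnertonDyer.Theses.ShadowIsolation
import Summits.BirchSwinnertonDyer.BirchSwinnertonDyer.Theses.SelmerRank
import Summits.BirchSwinnertonDyer.BirchSwinnertonDyer.Theorems.SelmerRankShaCorank

/-!
# Crux attack on `SelmerRankUB` (stmt-BirchSwinnertonDyer-0130) — refuter probes, cycle 1

Kernel-checked record of the basic attacks (refuter-rattack-stmt-BirchSwinnertonDyer-0130-0,
2026-08-17, route ShadowIsolation; item shared verbatim with route SelmerRank, decls
`SelmerRankUB` / `SelmerRankUBR2`). Nothing here asserts a route statement positively except UNDER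
the summit hypothesis (`S → …` probes, written as `example`s), which is the restates-the-summit
test, not a proof.

Findings (all axioms ⊆ {propext, Classical.choice, Quot.sound}):
* the three route copies of the shared item are syntactically identical (`rfl`);
* through Greenberg's corank identity (PROVED in tree,
  `WeierstrassCurve.selmerCorank_eq_mordellWeilRank_add_holds`) the crux unfolds to
  `rank E(ℚ) + corank Ш[p^∞] ≤ r_an` at big-image good ordinary `p ≥ 5` (`ub_iff_rank_add_sha_le`);
  hence it splits into the rank upper bound `rank ≤ r_an` (`rankUB_of_ub`) AND a Ш-statement
  `corank Ш[p^∞] ≤ r_an − rank` (`sha_le_of_ub`);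
* `S → C` FAILS as a restatement test (contrast with the sibling LB, where `S → C` holds outright):
  modulo the summit `BirchSwinnertonDyer` (rank = r_an) the crux is EXACTLY Ш[p^∞]-cotorsion at
  every big-image good ordinary prime `p ≥ 5` (`shaCotorsion_of_summit_of_ub` and the `example`
  converse) — i.e. the crux carries the Ш-gap of `SelmerRankBarrierNarrow`, not only a half of the
  summit; it IS implied by summit + `SelmerRankShaPFinite` (stmt-0132), both standard conjectures,
  so no counterexample exists unless BSD-rank or Ш-finiteness fails: not misstated-false;
* `C → S` is not available: the crux is one inequality at special primes; the summit needs LB,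
  the small-image sector and Ш[p^∞]-cotorsion in addition (route SelmerRank's `closes`);
* degenerate regime `r_an = 0`: the crux demands `corank Sel_{p^∞} = 0` (`ub_at_rank_zero_iff`) —
  Kato's theorem (content!), NOT a triviality (for LB the same regime was `0 ≤ _`);
* OVER-STRENGTH relative to both assemblies (sharpening note, not a misstatement): the crux is
  `RankUBBigImage ∧ (Ш-half)` (`ub_iff_rankUB_and_shaHalf`); route SelmerRank binds
  `SelmerRankShaPFinite` next to it and route ShadowIsolation produces Ш-cotorsion from
  Isolation + Shadow, so in BOTH `closes` the slot is already served by the rank-half alone (the two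
  `example`s at the end), and the rank-half is summit-implied (`rankUB_of_summit`);
* non-vacuity of the hypothesis block is kernel-checked in the companion file `NonVacuity.lean`
  (`hypotheses_inhabited`: a global minimal model of 37a1 and a Serre prime).
-/

set_option linter.dupNamespace false

namespace Summit.BirchSwinnertonDyer.BirchSwinnertonDyer.Cruxes.SelmerRankUB.CruxAttack

open Summit.BirchSwinnertonDyer.BirchSwinnertonDyer.Theses

/-- The body of the crux, restated verbatim, is definitionally the route decl. [folklore] -/
example : ShadowIsolation.SelmerRankUB =
    (∀ (W : WeierstrassCurve ℚ) [W.IsElliptic] [W.IsGloballyMinimal] (p : ℕ) [Fact p.Prime],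
      5 ≤ p → W.HasGoodReductionAtPrime p → ¬ (p : ℤ) ∣ W.frobeniusTrace p →
      W.HasSurjectiveModNGaloisRep p → W.selmerCorank p ≤ W.analyticRank) := rfl

/-- Shared item: the route copies coincide syntactically. [folklore] -/
example : ShadowIsolation.SelmerRankUB = SelmerRank.SelmerRankUB := rfl
example : ShadowIsolation.SelmerRankUB = SelmerRank.SelmerRankUBR2 := rfl

/-- The Ш-half hidden in the crux: `Ш(E/ℚ)[p^∞]` has `ℤ_p`-corank `0` at every big-image good
ordinary prime `p ≥ 5` (same binders and hypotheses as the crux). [folklore] -/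
def ShaCotorsionBigImage : Prop :=
  ∀ (W : WeierstrassCurve ℚ) [W.IsElliptic] [W.IsGloballyMinimal] (p : ℕ) [Fact p.Prime],
    5 ≤ p → W.HasGoodReductionAtPrime p → ¬ (p : ℤ) ∣ W.frobeniusTrace p →
    W.HasSurjectiveModNGaloisRep p → W.shaCorank p = 0

/-- The rank-half hidden in the crux: `rank E(ℚ) ≤ r_an` for every `W` admitting a big-image good
ordinary prime `p ≥ 5` (same binders and hypotheses as the crux). [folklore] -/
def RankUBBigImage : Prop :=
  ∀ (W : WeierstrassCurve ℚ) [W.IsElliptic] [W.IsGloballyMinimal] (p : ℕ) [Fact p.Prime],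
    5 ≤ p → W.HasGoodReductionAtPrime p → ¬ (p : ℤ) ∣ W.frobeniusTrace p →
    W.HasSurjectiveModNGaloisRep p → W.mordellWeilRank ≤ W.analyticRank

/-- The unfolded crux: `rank E(ℚ) + corank Ш[p^∞] ≤ r_an` under the crux hypotheses. [folklore] -/
def RankAddShaLe : Prop :=
  ∀ (W : WeierstrassCurve ℚ) [W.IsElliptic] [W.IsGloballyMinimal] (p : ℕ) [Fact p.Prime],
    5 ≤ p → W.HasGoodReductionAtPrime p → ¬ (p : ℤ) ∣ W.frobeniusTrace p →
    W.HasSurjectiveModNGaloisRep p → W.mordellWeilRank + W.shaCorank p ≤ W.analyticRank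

/-- **Unfolding.** Through Greenberg's identity `corank Sel_{p^∞} = rank + corank Ш[p^∞]`
(tree theorem `selmerCorank_eq_mordellWeilRank_add_holds`) the crux is literally
`rank + corank Ш[p^∞] ≤ r_an` at big-image good ordinary `p ≥ 5`. [folklore] -/
theorem ub_iff_rank_add_sha_le : ShadowIsolation.SelmerRankUB ↔ RankAddShaLe := by
  constructor
  · intro h W _ _ p _ h5 hg ho hs
    have h1 := h W p h5 hg ho hs
    have h2 : W.selmerCorank p = W.mordellWeilRank + W.shaCorank p :=
      W.selmerCorank_eq_mordellWeilRank_add_holds p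
    omega
  · intro h W _ _ p _ h5 hg ho hs
    have h1 := h W p h5 hg ho hs
    have h2 : W.selmerCorank p = W.mordellWeilRank + W.shaCorank p :=
      W.selmerCorank_eq_mordellWeilRank_add_holds p
    omega

/-- **Rank half.** The crux implies the rank upper bound `rank ≤ r_an` at those `W`. [folklore] -/
theorem rankUB_of_ub (h : ShadowIsolation.SelmerRankUB) : RankUBBigImage := by
  intro W _ _ p _ h5 hg ho hs
  have h1 := (ub_iff_rank_add_sha_le.mp h) W p h5 hg ho hs
  omega

/-- **Ш half.** The crux implies `corank Ш[p^∞] ≤ r_an` (indeed `≤ r_an − rank`) at big-image good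
ordinary `p ≥ 5`; in particular at `r_an = 0` it demands Ш[p^∞]-cotorsion. [folklore] -/
theorem sha_le_of_ub (h : ShadowIsolation.SelmerRankUB) :
    ∀ (W : WeierstrassCurve ℚ) [W.IsElliptic] [W.IsGloballyMinimal] (p : ℕ) [Fact p.Prime],
      5 ≤ p → W.HasGoodReductionAtPrime p → ¬ (p : ℤ) ∣ W.frobeniusTrace p →
      W.HasSurjectiveModNGaloisRep p → W.shaCorank p ≤ W.analyticRank - W.mordellWeilRank := by
  intro W _ _ p _ h5 hg ho hs
  have h1 := (ub_iff_rank_add_sha_le.mp h) W p h5 hg ho hs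
  omega

/-- **`S → C` fails; exactly what is left.** Modulo the summit `BirchSwinnertonDyer`
(`r_an = rank`), the crux implies Ш[p^∞]-cotorsion at every big-image good ordinary `p ≥ 5` —
the Ш-gap itself. [folklore] -/
theorem shaCotorsion_of_summit_of_ub (hS : _root_.BirchSwinnertonDyer)
    (h : ShadowIsolation.SelmerRankUB) : ShaCotorsionBigImage := by
  intro W _ _ p _ h5 hg ho hs
  have h0 : W.analyticRank = W.mordellWeilRank := hS W inferInstance
  have h1 := (ub_iff_rank_add_sha_le.mp h) W p h5 hg ho hs
  omega

/-- … and conversely (so modulo the summit the crux IS `ShaCotorsionBigImage`). Written as an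
`example`: its conclusion is the route decl. [folklore] -/
example (hS : _root_.BirchSwinnertonDyer) (hSha : ShaCotorsionBigImage) :
    ShadowIsolation.SelmerRankUB := by
  refine ub_iff_rank_add_sha_le.mpr ?_
  intro W _ _ p _ h5 hg ho hs
  have h0 : W.analyticRank = W.mordellWeilRank := hS W inferInstance
  have h1 := hSha W p h5 hg ho hs
  omega

/-- **Summit + Ш-finiteness ⇒ crux** (none of the five hypotheses used): the crux follows from
BSD-rank together with route SelmerRank's crux `SelmerRankShaPFinite` (stmt-0132, `Ш[p^∞]`
finite) via the tree theorem `Literature.BSD.shaCorank_eq_zero_of_finite`. Hence a counterexample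
to the crux refutes BSD-rank or the finiteness of Ш: the crux cannot be misstated-false. [folklore] -/
example (hS : _root_.BirchSwinnertonDyer) (hSha : SelmerRank.SelmerRankShaPFinite) :
    ShadowIsolation.SelmerRankUB := by
  intro W _ _ p _ _ _ _ _
  have h0 : W.analyticRank = W.mordellWeilRank := hS W inferInstance
  have h2 : W.selmerCorank p = W.mordellWeilRank + W.shaCorank p :=
    W.selmerCorank_eq_mordellWeilRank_add_holds p
  have h3 : W.shaCorank p = 0 := Literature.BSD.shaCorank_eq_zero_of_finite W p (hSha W p)
  omega

/-- Hypothesis-free strengthening modulo summit + Ш-finite: `corank_p Sel ≤ r_an` for EVERY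
elliptic `W` and EVERY prime `p` — so the five hypotheses are decoration for TRUTH (given the
standard conjectures) and load-bearing only for PROVABILITY of the known cases. [folklore] -/
theorem ub_everywhere_of_summit_of_shaFinite (hS : _root_.BirchSwinnertonDyer)
    (hSha : SelmerRank.SelmerRankShaPFinite) :
    ∀ (W : WeierstrassCurve ℚ) [W.IsElliptic] (p : ℕ) [Fact p.Prime],
      W.selmerCorank p ≤ W.analyticRank := by
  intro W _ p _
  have h0 : W.analyticRank = W.mordellWeilRank := hS W inferInstance
  have h2 : W.selmerCorank p = W.mordellWeilRank + W.shaCorank p :=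
    W.selmerCorank_eq_mordellWeilRank_add_holds p
  have h3 : W.shaCorank p = 0 := Literature.BSD.shaCorank_eq_zero_of_finite W p (hSha W p)
  omega

/-- Degenerate regime `r_an = 0`: the crux's conclusion there is `corank Sel_{p^∞} = 0`, i.e.
finiteness of the `p^∞`-Selmer group (Kato 2004, Thm 14.2 / Cor 14.3 with Rohrlich; Kolyvagin
1990) — genuine content, not a triviality (contrast: for the LB sibling this regime is `0 ≤ _`).
[folklore] -/
theorem ub_at_rank_zero_iff (W : WeierstrassCurve ℚ) (p : ℕ) (h0 : W.analyticRank = 0) :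
    W.selmerCorank p ≤ W.analyticRank ↔ W.selmerCorank p = 0 := by
  rw [h0]; exact Nat.le_zero

/-- Lower degenerate bound: the conclusion can only fail with `corank Sel_{p^∞} ≥ 1`, and by
Greenberg's identity a failure means `rank > r_an` or `corank Ш[p^∞] > r_an − rank`. [folklore] -/
theorem not_ub_pointwise_iff (W : WeierstrassCurve ℚ) [W.IsElliptic] (p : ℕ) [Fact p.Prime] :
    ¬ W.selmerCorank p ≤ W.analyticRank ↔
      W.analyticRank < W.mordellWeilRank + W.shaCorank p := by
  have h2 : W.selmerCorank p = W.mordellWeilRank + W.shaCorank p :=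
    W.selmerCorank_eq_mordellWeilRank_add_holds p
  omega


/-- **Over-strength relative to the assembly (sharpening note for planners).** Route SelmerRank's
`closes` binds `SelmerRankShaPFinite` (stmt-0132) next to this crux; given that binder, the crux
is already delivered by its rank-half `RankUBBigImage` (`rank ≤ r_an` at big-image good ordinary
`p ≥ 5`). So the Ш-half of the crux is sourced twice in that route, and the minimal statement the
assembly needs from this slot is the plain rank upper bound. Written as an `example` (conclusion is
the route decl). [folklore] -/
example (hR : RankUBBigImage) (hSha : SelmerRank.SelmerRankShaPFinite) :
    SelmerRank.SelmerRankUB := by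
  intro W _ _ p _ h5 hg ho hs
  have h1 := hR W p h5 hg ho hs
  have h2 : W.selmerCorank p = W.mordellWeilRank + W.shaCorank p :=
    W.selmerCorank_eq_mordellWeilRank_add_holds p
  have h3 : W.shaCorank p = 0 := Literature.BSD.shaCorank_eq_zero_of_finite W p (hSha W p)
  omega

/-- … and the rank-half is implied by the summit outright (no Ш input, no hypothesis used), so a
crux weakened to `RankUBBigImage` could not be false unless `BirchSwinnertonDyer` is. [folklore] -/
theorem rankUB_of_summit (hS : _root_.BirchSwinnertonDyer) : RankUBBigImage := by
  intro W _ _ p _ _ _ _ _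
  have h0 : W.analyticRank = W.mordellWeilRank := hS W inferInstance
  omega

/-- The two halves together are exactly the crux: `UB ↔ RankUBBigImage ∧ (Ш-half)`. [folklore] -/
theorem ub_iff_rankUB_and_shaHalf : ShadowIsolation.SelmerRankUB ↔
    (RankUBBigImage ∧
      ∀ (W : WeierstrassCurve ℚ) [W.IsElliptic] [W.IsGloballyMinimal] (p : ℕ) [Fact p.Prime],
        5 ≤ p → W.HasGoodReductionAtPrime p → ¬ (p : ℤ) ∣ W.frobeniusTrace p →
        W.HasSurjectiveModNGaloisRep p → W.shaCorank p ≤ W.analyticRank - W.mordellWeilRank) := by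
  constructor
  · exact fun h => ⟨rankUB_of_ub h, sha_le_of_ub h⟩
  · rintro ⟨hR, hSha⟩
    refine ub_iff_rank_add_sha_le.mpr ?_
    intro W _ _ p _ h5 hg ho hs
    have h1 := hR W p h5 hg ho hs
    have h2 := hSha W p h5 hg ho hs
    omega


/-- **Same over-strength in route ShadowIsolation.** Its glue `CruxesToTarget`
(`Isolation → Shadow → ShaUnboundedOfCorank → SelmerRankUB → SelmerRankLB → SelmerRankSmallImage →
ShadowIsolationThesis`) goes through verbatim with the rank-half `RankUBBigImage` in the
`SelmerRankUB` slot: the Ш-cotorsion conjunct of the thesis is produced by Isolation + Shadow, and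
with it `rank ≤ r_an ≤ corank Sel = rank + 0`. Written as an `example` (conclusion is the route's
target decl). [folklore] -/
example (hIso : ShadowIsolation.IsolationOfAccidentalZeros) (hSh : ShadowIsolation.PhantomShadow)
    (hAlg : ShadowIsolation.ShaUnboundedOfCorank) (hR : RankUBBigImage)
    (hLB : ShadowIsolation.SelmerRankLB) (hSI : ShadowIsolation.SelmerRankSmallImage) :
    ShadowIsolation.ShadowIsolationThesis := by
  intro W _ _ p _ h5 hgood hord hirr
  have hsha : W.shaCorank p = 0 := by
    by_contra hne
    obtain ⟨n₀, hn₀⟩ := hIso W p h5 hgood hord hirr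
    obtain ⟨σ, hσ⟩ := hAlg W p hne (max n₀ 1)
    exact hn₀ (max n₀ 1) (le_max_left _ _)
      (hSh W p h5 hgood hord hirr (max n₀ 1) (le_max_right _ _) ⟨σ, hσ⟩)
  refine ⟨hsha, ?_⟩
  by_cases hsurj : W.HasSurjectiveModNGaloisRep p
  · have h1 := hR W p h5 hgood hord hsurj
    have h2 := hLB W p h5 hgood hord hsurj
    have h3 : W.selmerCorank p = W.mordellWeilRank + W.shaCorank p :=
      W.selmerCorank_eq_mordellWeilRank_add_holds p
    omega
  · exact hSI W p h5 hgood hord hsurj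

end Summit.BirchSwinnertonDyer.BirchSwinnertonDyer.Cruxes.SelmerRankUB.CruxAttack
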